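import Mathlib
import Summits.PneNP.PneNP.Theorems.Nc03AvoidResidualCoreCandStarRead

/-!
# Route Nc03AvoidResidualCore, crux `CandStarReduction` (X₂) — the tangled-surplus solver, II: the cover count

Helper file for `stmt-PneNP-19963` (sequel of `…CandStarProgram`; cell pnp-ideate, rung F-N1b). On a genuine
pure-`CAND` instance `J` without parallel pairs, the greedy cherry family `cher (rawOf J)` is MAXIMAL; hence
every tangled output either has a forced data variable (it is COVERED, `TS J`) or is matched injectively to a
cherry edge (which is covered): **`#(tangled J) ≤ 2 · #(TS J)`** (`card_tangled_le`), so `2n+1` tangled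
outputs give `n+1` covered ones (`succ_le_card_TS`) — the count that makes the affine part of the solver
(`…CandStarAffine`) beat the `≤ n` unforced variables. (A variant of Lemma B.2 of the cell memo
pnp-ideate-p2/ROUND-3-ADDENDUM-B with pairwise DISJOINT cherries, which need no forcing-forest argument.)

Restricted-model (NC⁰₃) range-avoidance rung F-N1b of the PneNP frontier ladder; no bearing on P vs NP.
-/

set_option linter.dupNamespace false -- `Summit.PneNP.PneNP.…`: summit = sub-problem name (D-0017 single-conjunct layout)

namespace Summit.PneNP.PneNP.Theorems.Nc03CandStar

open Finset
open Literature.Computability.Complexity Nc03Reduction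
open Summit.PneNP.PneNP.Theorems.Nc03AvoidResidualCoreCandFewHeadsRungFP (tri)
open Summit.PneNP.PneNP.Theorems.Nc03AvoidResidualCoreCandFewHeadsRung (pset pset_card)
open Summit.PneNP.PneNP.Theorems.Nc03AvoidResidualCoreCandCherry (tangled mem_tangled)

variable {N M : ℕ}

/-! ## Forced variables, covered outputs, cherry edges -/

/-- The forced variables: apexes of the chosen cherries. -/
def FS (J : LocalMap 3 N M) : Finset (Fin N) := univ.filter fun u => isF (cher (rawOf J)) u.val = true

/-- The covered outputs: a data variable is forced. -/
def TS (J : LocalMap 3 N M) : Finset (Fin M) :=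
  univ.filter fun o => covB (rawOf J).2.2 (cher (rawOf J)) o.val = true

/-- The cherry edges. -/
def CE (J : LocalMap 3 N M) : Finset (Fin M) := univ.filter fun o => o.val ∈ edgeL (cher (rawOf J))

variable (J : LocalMap 3 N M)

/-- Membership in `FS`. -/
theorem mem_FS_iff {u : Fin N} : u ∈ FS J ↔ ∃ q ∈ cher (rawOf J), q.1 = u.val := by
  unfold FS; rw [mem_filter, isF_iff]; simp

/-- Membership in `TS`. -/
theorem mem_TS_iff {o : Fin M} : o ∈ TS J ↔ J.vars o 1 ∈ FS J ∨ J.vars o 2 ∈ FS J := by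
  unfold TS FS covB
  simp only [mem_filter, mem_univ, true_and, tri_rawOf, tripOf, Bool.or_eq_true]

/-- Membership in `CE`. -/
theorem mem_CE_iff {o : Fin M} : o ∈ CE J ↔ ∃ q ∈ cher (rawOf J), q.2.1 = o.val ∨ q.2.2 = o.val := by
  unfold CE; rw [mem_filter, mem_edgeL_iff]; simp

/-- A non-head role is `1` or `2`. -/
theorem role_cases {r : Fin 3} (hr : r ≠ 0) : r = 1 ∨ r = 2 := by
  rcases r with ⟨_ | _ | _ | r, h3⟩
  · exact absurd rfl hr
  · exact Or.inl rfl
  · exact Or.inr rfl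
  · omega

/-- An output one of whose data variables is forced is covered. -/
theorem mem_TS_of_data {o : Fin M} {r : Fin 3} (hr : r ≠ 0) (h : J.vars o r ∈ FS J) : o ∈ TS J := by
  rw [mem_TS_iff]
  rcases role_cases hr with rfl | rfl
  · exact Or.inl h
  · exact Or.inr h

/-- **Cherry edges are covered** (they contain their forced apex in a data role). -/
theorem mem_TS_of_mem_CE {o : Fin M} (h : o ∈ CE J) : o ∈ TS J := by
  obtain ⟨q, hq, ho⟩ := (mem_CE_iff J).1 h
  obtain ⟨j, j', u, rfl, -, -, r, r', hr, hr', hjr, hj'r⟩ := cher_spec J hq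
  have hu : u ∈ FS J := (mem_FS_iff J).2 ⟨_, hq, rfl⟩
  rcases ho with ho | ho
  · have : j = o := Fin.ext ho
    subst this
    exact mem_TS_of_data J hr (hjr ▸ hu)
  · have : j' = o := Fin.ext ho
    subst this
    exact mem_TS_of_data J hr' (hj'r ▸ hu)

/-- `CE ⊆ TS`. -/
theorem CE_subset_TS : CE J ⊆ TS J := fun _ h => mem_TS_of_mem_CE J h

/-- A data variable lies in the data pair. -/
theorem vars_mem_pset (o : Fin M) {r : Fin 3} (hr : r ≠ 0) : J.vars o r ∈ pset J o := by
  unfold pset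
  rcases role_cases hr with rfl | rfl <;> simp

/-- **Two distinct common data variables make a parallel pair** (pure instances: data pairs have two
elements). -/
theorem pset_eq_of_two_common (hI : J.IsPure candPred) {a b : Fin M} {w w' : Fin N} (hww : w ≠ w')
    (hwa : w ∈ pset J a) (hwb : w ∈ pset J b) (hw'a : w' ∈ pset J a) (hw'b : w' ∈ pset J b) :
    pset J a = pset J b := by
  have hsub : ∀ c : Fin M, w ∈ pset J c → w' ∈ pset J c → ({w, w'} : Finset (Fin N)) = pset J c := by
    intro c hwc hw'c
    apply Finset.eq_of_subset_of_card_le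
    · intro x hx
      rcases Finset.mem_insert.1 hx with rfl | hx
      · exact hwc
      · rw [Finset.mem_singleton.1 hx]; exact hw'c
    · rw [pset_card hI, Finset.card_pair hww]
  rw [← hsub a hwa hw'a, hsub b hwb hw'b]

/-- **Maximality on a genuine instance.** Without parallel pairs, two distinct outputs with equal heads
sharing the data variable `w` meet the chosen cherries: `w` is forced, or one of them is a cherry edge. -/
theorem maximal (hI : J.IsPure candPred) (hP : findPar (rawOf J) = none) {j j'' : Fin M} (hne : j ≠ j'')
    (hh : J.vars j 0 = J.vars j'' 0) {r r'' : Fin 3} (hr : r ≠ 0) (hr'' : r'' ≠ 0)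
    (hw : J.vars j r = J.vars j'' r'') : J.vars j r ∈ FS J ∨ j ∈ CE J ∨ j'' ∈ CE J := by
  rw [findPar_eq_none_iff] at hP
  -- order the pair
  have key : ∀ a b : Fin M, a < b → J.vars a 0 = J.vars b 0 → ∀ s s' : Fin 3, s ≠ 0 → s' ≠ 0 →
      J.vars a s = J.vars b s' → J.vars a s ∈ FS J ∨ a ∈ CE J ∨ b ∈ CE J := by
    intro a b hab hhab s s' hs hs' hss'
    have hsh : shareB (rawOf J).2.2 (a.val, b.val) = true :=
      (shareB_iff J a b).2 ⟨hab, hhab, s, s', hs, hs', hss'⟩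
    obtain ⟨q, hq, hqc⟩ := cher_maximal J hsh
    obtain ⟨t, t', ht, ht', hval, htt'⟩ := apexOf_spec J hsh
    -- the apex is THE common data variable
    have hapex : J.vars a t = J.vars a s := by
      by_contra hne'
      apply hP a b (ne_of_lt hab) hhab
      exact pset_eq_of_two_common J hI hne' (vars_mem_pset J a ht) (htt' ▸ vars_mem_pset J b ht')
        (vars_mem_pset J a hs) (hss' ▸ vars_mem_pset J b hs')
    rcases hqc with h1 | h2 | h3 | h4 | h5
    · left
      rw [(mem_FS_iff J)]
      exact ⟨q, hq, by rw [h1, ← hval, hapex]⟩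
    · exact Or.inr (Or.inl ((mem_CE_iff J).2 ⟨q, hq, Or.inl h2⟩))
    · exact Or.inr (Or.inr ((mem_CE_iff J).2 ⟨q, hq, Or.inl h3⟩))
    · exact Or.inr (Or.inl ((mem_CE_iff J).2 ⟨q, hq, Or.inr h4⟩))
    · exact Or.inr (Or.inr ((mem_CE_iff J).2 ⟨q, hq, Or.inr h5⟩))
  rcases lt_or_gt_of_ne hne with hlt | hgt
  · exact key j j'' hlt hh r r'' hr hr'' hw
  · rcases key j'' j hgt hh.symm r'' r hr'' hr hw.symm with h | h | h
    · exact Or.inl (hw ▸ h)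
    · exact Or.inr (Or.inr h)
    · exact Or.inr (Or.inl h)

/-! ## The count -/

/-- Every uncovered tangled output has a PARTNER: a cherry edge with the same head sharing with it an
UNFORCED data variable. -/
theorem exists_partner (hI : J.IsPure candPred) (hP : findPar (rawOf J) = none) {o : Fin M}
    (ho : o ∈ tangled J) (hoT : o ∉ TS J) :
    ∃ o', o' ∈ CE J ∧ J.vars o' 0 = J.vars o 0 ∧ ∃ r r' : Fin 3, r ≠ 0 ∧ r' ≠ 0 ∧
      J.vars o r = J.vars o' r' ∧ J.vars o r ∉ FS J := by
  obtain ⟨o', hne, hh, r, r', hr, hr', hrr⟩ := mem_tangled.1 ho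
  have hw : J.vars o r ∉ FS J := fun h => hoT (mem_TS_of_data J hr h)
  rcases maximal J hI hP (Ne.symm hne) hh.symm hr hr' hrr with h | h | h
  · exact absurd h hw
  · exact absurd (mem_TS_of_mem_CE J h) hoT
  · exact ⟨o', h, hh, r, r', hr, hr', hrr, hw⟩

/-- The data variables of a cherry edge: its apex (forced) in one data role. -/
theorem exists_apex_role {o' : Fin M} (hq : o' ∈ CE J) : ∃ r₀ : Fin 3, r₀ ≠ 0 ∧ J.vars o' r₀ ∈ FS J := by
  obtain ⟨q, hq, ho⟩ := (mem_CE_iff J).1 hq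
  obtain ⟨j, j', u, rfl, -, -, r, r', hr, hr', hjr, hj'r⟩ := cher_spec J hq
  have hu : u ∈ FS J := (mem_FS_iff J).2 ⟨_, hq, rfl⟩
  rcases ho with ho | ho
  · have : j = o' := Fin.ext ho
    subst this; exact ⟨r, hr, hjr ▸ hu⟩
  · have : j' = o' := Fin.ext ho
    subst this; exact ⟨r', hr', hj'r ▸ hu⟩

/-- Two distinct non-head roles are `1, 2` in some order: the third data reading is one of them. -/
theorem role_eq_or_eq {r₀ s : Fin 3} (hr₀ : r₀ ≠ 0) (hs : s ≠ 0) (hne : s ≠ r₀) {s' : Fin 3} (hs' : s' ≠ 0)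
    (hne' : s' ≠ r₀) : s' = s := by
  rcases role_cases hr₀ with rfl | rfl <;> rcases role_cases hs with rfl | rfl <;>
    rcases role_cases hs' with rfl | rfl <;> simp_all

/-- **Partners are injective**: two uncovered tangled outputs with a common partner coincide. -/
theorem partner_inj (hI : J.IsPure candPred) (hP : findPar (rawOf J) = none) {o₁ o₂ o' : Fin M}
    (ho₁ : o₁ ∉ TS J) (ho₂ : o₂ ∉ TS J)
    (h₁ : o' ∈ CE J ∧ J.vars o' 0 = J.vars o₁ 0 ∧ ∃ r r' : Fin 3, r ≠ 0 ∧ r' ≠ 0 ∧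
      J.vars o₁ r = J.vars o' r' ∧ J.vars o₁ r ∉ FS J)
    (h₂ : o' ∈ CE J ∧ J.vars o' 0 = J.vars o₂ 0 ∧ ∃ r r' : Fin 3, r ≠ 0 ∧ r' ≠ 0 ∧
      J.vars o₂ r = J.vars o' r' ∧ J.vars o₂ r ∉ FS J) : o₁ = o₂ := by
  obtain ⟨hq, hh₁, r₁, s₁, hr₁, hs₁, hw₁, hF₁⟩ := h₁
  obtain ⟨-, hh₂, r₂, s₂, hr₂, hs₂, hw₂, hF₂⟩ := h₂
  obtain ⟨r₀, hr₀, hapex⟩ := exists_apex_role J hq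
  -- the shared unforced variables are read by `o'` in the same (non-apex) role
  have hs₁r : s₁ ≠ r₀ := by
    rintro rfl
    exact hF₁ (by rw [hw₁]; exact hapex)
  have hs₂r : s₂ ≠ r₀ := by
    rintro rfl
    exact hF₂ (by rw [hw₂]; exact hapex)
  have hs₂₁ : s₂ = s₁ := role_eq_or_eq hr₀ hs₁ hs₁r hs₂ hs₂r
  have hw : J.vars o₁ r₁ = J.vars o₂ r₂ := by rw [hw₁, hw₂, hs₂₁]
  by_contra hne
  rcases maximal J hI hP hne (hh₁.symm.trans hh₂) hr₁ hr₂ hw with h | h | h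
  · exact hF₁ h
  · exact ho₁ (mem_TS_of_mem_CE J h)
  · exact ho₂ (mem_TS_of_mem_CE J h)

/-- **The cover count**: without parallel pairs, `#(tangled J) ≤ 2 · #(TS J)`. -/
theorem card_tangled_le (hI : J.IsPure candPred) (hP : findPar (rawOf J) = none) :
    #(tangled J) ≤ 2 * #(TS J) := by
  classical
  -- split the tangled outputs into covered and uncovered ones
  have hsplit := Finset.card_filter_add_card_filter_not (s := tangled J) (fun o => o ∈ TS J)
  have h1 : #((tangled J).filter fun o => o ∈ TS J) ≤ #(TS J) :=
    Finset.card_le_card fun o ho => (Finset.mem_filter.1 ho).2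
  -- the uncovered ones inject into the cherry edges, which are covered
  let P : Fin M → Fin M → Prop := fun o o' => o' ∈ CE J ∧ J.vars o' 0 = J.vars o 0 ∧
    ∃ r r' : Fin 3, r ≠ 0 ∧ r' ≠ 0 ∧ J.vars o r = J.vars o' r' ∧ J.vars o r ∉ FS J
  let φ : Fin M → Fin M := fun o => if h : ∃ o', P o o' then Classical.choose h else o
  have hφ : ∀ o ∈ (tangled J).filter (fun o => o ∉ TS J), P o (φ o) := by
    intro o ho
    obtain ⟨hot, hoT⟩ := Finset.mem_filter.1 ho
    have hex : ∃ o', P o o' := exists_partner J hI hP hot hoT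
    have hφo : φ o = Classical.choose hex := dif_pos hex
    rw [hφo]
    exact Classical.choose_spec hex
  have h2 : #((tangled J).filter fun o => o ∉ TS J) ≤ #(TS J) := by
    apply Finset.card_le_card_of_injOn φ
    · intro o ho
      exact mem_TS_of_mem_CE J (hφ o ho).1
    · intro o₁ ho₁ o₂ ho₂ heq
      have hp₁ := hφ o₁ ho₁
      have hp₂ := hφ o₂ ho₂
      rw [heq] at hp₁
      exact partner_inj J hI hP (Finset.mem_filter.1 (Finset.mem_coe.1 ho₁)).2
        (Finset.mem_filter.1 (Finset.mem_coe.1 ho₂)).2 hp₁ hp₂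
  omega

/-- **`2n+1` tangled outputs give `n+1` covered outputs.** -/
theorem succ_le_card_TS (hI : J.IsPure candPred) (hP : findPar (rawOf J) = none)
    (hL : 2 * N + 1 ≤ #(tangled J)) :
    N + 1 ≤ #(TS J) := by
  have := card_tangled_le J hI hP
  omega

end Summit.PneNP.PneNP.Theorems.Nc03CandStar
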